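import Literature.MathematicalPhysics.QuantumFieldTheory.Balaban1983to89.DagDischargedII
import Literature.MathematicalPhysics.QuantumFieldTheory.Balaban1983to89.B8Thm8FlatAbelianFamily
import Literature.MathematicalPhysics.QuantumFieldTheory.Balaban1983to89.B8Prop7HalfSpace

/-!
# `Balaban1983to89.B8LeafKnit` — T. Bałaban, *Spaces of regular gauge field configurations on a lattice and gauge fixing
# conditions*, Commun. Math. Phys. **99** (1985) 75–102 [Balaban1985RegularSpaces] = cell paper B8, DAG node **N05**
# (`Dag.B8_main ℓ := ℓ.b5 → ℓ.b6 → ℓ.b7 → ℓ.b9 → ℓ.b8`, `Dag.lean` :198): the KNIT BY NAME of the faithful leaf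
# `DagBinding.B8LeafR` (Lemma 1 p. 79 · Thm 2 p. 83 · Prop 3 p. 87 · Thm 4 p. 88 · Prop 5 p. 94 · Prop 6 p. 99 · Prop 7 p. 100 ·
# Thm 8 p. 101) from the tree's own reductions, the node at an N-binding run, and the KERNEL FORM of the two located hazards on the
# shared gauge-fixing family (Thm 8 as printed, GAPS G-B8-13; Prop 7 printed-R, NODE 00 question N0-6)

statement-level skeleton of published theorems with citation tags; proofs where landed; nothing here is a claim about the Yang–Mills mass gap

CITATION HEADER (lean-in-tree rule).  Cell `pub-ymgap` (YM-PLAN Track A, HUMAN RULING D-0062 «Track A at full width»), seat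
`pub-ymgap-dag-n05-a` = the KNIT-BY-NAME seat of node N05 (director-ym LINE №9, chair R429, ROSTER-D0062, dag-lead NODE-TABLE v1 row n05:
«knit `B8LeafR` from REST-lemmas with Thm 2∕Thm 4∕Prop 5 as named hypotheses NOW (discharge-shaped file, hypotheses shrink as -b lands)»).
PDF held: `paper:balaban1985-cmp99-regular-spaces-gauge-fixing` (journal page = PDF page + 74); the printed statements are QUOTED
VERBATIM in the docstrings of the typed leaves this file names (`B8.Lemma1Printed` … `B8.Thm8Printed`, `B8SectGH.Prop7PrintedR`,
`B8SectGH.Thm8PrintedAt`) and are not re-quoted here.  THEOREMS ONLY: no `def`, no new `… : Prop` fact, no carrier, no instance;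
imports `…DagDischargedII` (the N-binding `Upstream.ofPrintedAllXPN` and the block-pair Lemma-1 carriers), `…B8Thm8FlatAbelianFamily`,
`…B8Prop7HalfSpace` (the two kernel refutations of record).

## WHAT THE NODE IS (tree, by name)

`Dag.B8_main (DagBinding.leavesP w P)` unfolds to `(w.up P).b5 → (w.up P).b6 → (w.up P).b7 → (w.up P).b9 → (w.up P).b8`; at a run bound by
`w.up P = Upstream.ofPrintedAllXPN X Y Z V W` (NODE 00's binding of record, every stage) the consequent IS, definitionally, the faithful leaf
`B8LeafR X.d8 X.L8 X.C₂ X.B₁' X.B₀' X.B₁ X.B₂ X.c₁ X.inp8 X.B₀β X.loc8 X.fam8R X.lan8 X.cub8 X.toAxial8` (`DagBinding` §(v4); `ofPrintedAllXPN_b8_iff`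
below) — NINE conjuncts `l1 t2 p3 t4 p5e p5u p6 p7 t8` over the run's B8 carrier group, of which FIVE (`t2 p3 t4 p7 t8`) read ONE AND THE SAME
gauge-fixing family `fam8R : I8b → B8SectGH.GFData3`.  NODE 00 Stages 1–3 (`Node00.Carriers`, `Carriers2`, `Carriers3`) pin the B4, B5, B6, B7
groups and leave the B8 group FREE (`Node00.CarriersFrame.carriers₁_groupB8`, `b8_main_iff_of_up`); which B8 family is «of record» is NODE 00
question N0-6.  Hence every theorem below is stated with the carrier bundle `X` as an EXPLICIT PARAMETER (chair R429 (3) ∕ R422 typing policy: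
«typed over the pinned carriers of record, or with an explicit parameter — never closed over the unpinned Stage-2∕3 frame»).

## WHAT THIS FILE PROVES (0 sorry; axioms {propext, Classical.choice, Quot.sound})

§1 RE-INDEXING.  The abstract leaves are monotone under restriction of the family index: `thm2Printed_precomp`, `thm4Printed_precomp`,
   `prop3Printed_precomp`, `prop7PrintedR_precomp`, `thm8PrintedAt_precomp` (a sub-family of a family satisfying the printed sentence
   satisfies it, same constants).  Pure logic; used in §4.
§2 THE ABSTRACT KNIT `b8LeafR_knit`: the faithful leaf from EIGHT of its nine printed statements — Theorem 2 is DERIVED, by the tree's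
   kernel form of the printed reduction «Theorem 4 + Proposition 3 + (1.65) ⇒ Theorem 2» (p. 88; `B8.thm2_of_thm4_prop3`, sub-cell b08),
   from `t4`, `p3` and that theorem's six displayed carrier laws (`h165` (1.65), `hginv` gauge invariance of 𝔄_k, `h137` (1.37) from the
   construction, `h136_162` (1.62) ⊂ (1.36), `hmono162`, `hmono137`) with the constant side conditions `1 ≤ d`, `0 < L`, `0 < B₀(β₀)`,
   `0 ≤ C₂`, `5dLB₀ ≤ B′₁`; `b8LeafR_knit_blockPairNA`: the same with Lemma 1 CONSUMED BY NAME on the non-abelian block-pair carriers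
   `B8Lemma1NonAbelian.blockPairNA d Lb 𝔸` (`DagDischargedII.lemma1Printed_blockPairNA`) — seven named printed hypotheses remain
   (`p3 t4 p5e p5u p6 p7 t8`), the list the -b seats shrink.
§3 THE NODE: `b8_main_of_leaf` (the leaf gives N05, in-edges discarded — the shape of N04's knit `Node00.b7_main_of_isWorldOfRecord₂`),
   `b8_main_iff_leaf` (given the four in-edge leaves, N05 IS the leaf), `ofPrintedAllXPN_b8_iff` (the N-binding's `b8` field IS `B8LeafR`
   over `X`'s group, `Iff.rfl`), `b8_main_of_up` ∕ `b8_main_of_up_knit` ∕ `b8_main_of_up_knit_withBlockPairNA` — N05 at any run bound by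
   `ofPrintedAllXPN X Y Z V W`, from the leaf ∕ from the §2 knit over `X`'s own B8 data ∕ idem with `X.withBlockPairNA Lb 𝔸`.
§4 THE TWO LOCATED HAZARDS IN NODE FORM (what a B8 family of record must avoid, or what must be re-typed first):
   (t8) `not_thm8PrintedAt_of_flat_subfamily`: a gauge-fixing family that CONTAINS print's admitted flat abelian torus instances at every
   number of RG steps `K` (index map `e : ℕ → I`, `fam (e K) = B8Thm8FlatAbelianFamily.flatGF (withK P K)`, `d ≥ 2`) does NOT satisfy
   Theorem 8 as printed at γ = 1, for ANY constants `B₁, B₂` (by §1 from `B8Thm8FlatAbelianFamily.not_thm8PrintedAt`, GAPS G-B8-13: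
   the ∇-member of (1.36) fails `K`-uniformly for sources with `|f|₍₋₂₎ < γ(α₀ + α₁)` only); hence `not_b8LeafR_of_flat_subfamily` (the
   faithful leaf is FALSE over any such family, whatever the other eight conjuncts' data), `not_ofPrintedAllXPN_b8_of_flat_subfamily`, and
   `b8_main_iff_inEdge_fails_of_flat_subfamily`: at a run so bound, **N05 holds iff one of its in-edge leaves b5, b6, b7, b9 FAILS** —
   ex falso only (YM-PLAN §1 vacuity guard, kernel form).  (p7) `not_b8LeafR_halfspace`: over r05's half-space packaging
   `B8Prop7HalfSpace.halfspaceGF 4 3 0 ℂ` the leaf is false through `p7` (`not_prop7PrintedR_halfspace`; N0-6, already on the node row).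
   CONSEQUENCE (bookkeeping, not a ruling): a B8 family of record carrying `B8LeafR` AS TYPED must exclude the admitted flat instances
   «Ω_j = T_η, U₀ = 1, U′ = 1» that print's Theorem 8 quantifies over («for arbitrary U₀, U′U₀ satisfying (1.33)–(1.35)») — i.e. conjunct
   `t8` needs the carver's RE-TYPING (surviving ∕ inspected form `B8.Thm8Inspected`, `B8SectDSource.thm8_sectD_inspected`, r05's
   `B8Thm8MultiLevelTorus.thm8_multiLevelTorus_V1_surviving`) before N05 can be discharged at honest carriers; the series' consumer of
   Theorem 8 ([Balaban1985Variational] (125) p. 297) uses only the surviving part (pub-balaban GAPS G-B11-E3a), so nothing downstream moves.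

HONEST SCOPE ∕ NOT CLAIMED.  (i) COUNT-NEUTRAL: no conjunct of the leaf is proved here beyond what the imports prove (Lemma 1 on the block-pair
carriers); `p3 t4 p5e p5u p6 p7 t8` are HYPOTHESES of the knit, named by their tree `Prop`s; this is NOT a discharge of N05 and moves no count.
(ii) The in-edges b5, b6, b7, b9 are DISCHARGED UNUSED by the knit (as N04's): print uses [2] = B5∕B6, [3] = B7, [4] = B9 inside the PROOFS of
Prop 3 ∕ (1.65) ∕ (1.92) ∕ Prop 5, i.e. inside the hypotheses named here, over carriers for which the tree has no dictionary to `X`'s B5–B9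
groups; threading them is the -b seats' estimate work, not bookkeeping.  (iii) §4 refutes NOTHING printed beyond what `B8Thm8FlatAbelianFamily` ∕
`B8Prop7HalfSpace` already refute (one clause of Theorem 8 for `|f|₍₋₂₎`-sources; Prop 7's constant on half-spaces); it only transports those
kernel facts to the node's leaf and to the node.  (iv) One finite four-torus programme at fixed ε, Bałaban AS PRINTED with locators; nothing
continuum ∕ ℝ⁴ ∕ OS ∕ mass gap ∕ Clay.
-/

namespace Literature.MathematicalPhysics.QuantumFieldTheory.Balaban1983to89.B8LeafKnit

open DagBinding DagDischarged DagDischargedII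

/-! ## §1 Re-indexing: the printed sentences pass to sub-families -/

section Reindex

variable {I J : Type} (e : J → I)

/-- Theorem 2 (p. 83) for a family gives Theorem 2 for every sub-family (same constants `B₁, B₂(β₀), c₁`). Pure logic.
[cite: Balaban1985RegularSpaces, Thm 2 p.83 (bookkeeping: restriction of the family index)] -/
theorem thm2Printed_precomp (fam : I → B8.GFData) (h : B8.Thm2Printed fam) : B8.Thm2Printed (fun j => fam (e j)) := by
  obtain ⟨B₁, B₂, c₁, hB₁, hB₂, hc₁, H⟩ := h
  exact ⟨B₁, B₂, c₁, hB₁, hB₂, hc₁, fun j => H (e j)⟩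

/-- Theorem 4 (p. 88) for a family gives Theorem 4 for every sub-family (same `B′₁, c₁`). Pure logic.
[cite: Balaban1985RegularSpaces, Thm 4 p.88 (bookkeeping: restriction of the family index)] -/
theorem thm4Printed_precomp (B₁' : ℝ) (fam : I → B8.GFData) (h : B8.Thm4Printed B₁' fam) :
    B8.Thm4Printed B₁' (fun j => fam (e j)) := by
  obtain ⟨c₁, hc₁, H⟩ := h
  exact ⟨c₁, hc₁, fun j => H (e j)⟩

/-- Proposition 3 (p. 87) for a family gives Proposition 3 for every sub-family (same threshold). Pure logic.
[cite: Balaban1985RegularSpaces, Prop. 3 p.87 (bookkeeping: restriction of the family index)] -/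
theorem prop3Printed_precomp (d : ℕ) (L C₂ : ℝ) (inp : B8.B9Inputs) (B₀β : ℝ) (fam : I → B8.GFData2)
    (h : B8.Prop3Printed d L C₂ inp B₀β fam) : B8.Prop3Printed d L C₂ inp B₀β (fun j => fam (e j)) := by
  obtain ⟨c, hc, H⟩ := h
  exact ⟨c, hc, fun j => H (e j)⟩

/-- Proposition 7 in the faithful reading (p. 100, `B8SectGH.Prop7PrintedR`) for a family gives it for every sub-family, with the
restricted axial-gauge map. Pure logic. [cite: Balaban1985RegularSpaces, Prop. 7 p.100 (bookkeeping: restriction of the family index)] -/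
theorem prop7PrintedR_precomp (fam : I → B8SectGH.GFData3) (toAxial : ∀ i, (fam i).Cfg → (fam i).Pert → (fam i).Pert)
    (h : B8SectGH.Prop7PrintedR fam toAxial) : B8SectGH.Prop7PrintedR (fun j => fam (e j)) (fun j => toAxial (e j)) := by
  obtain ⟨c, hc, H⟩ := h
  exact ⟨c, hc, fun j => H (e j)⟩

/-- Theorem 8 at one γ (p. 101, `B8SectGH.Thm8PrintedAt γ`) for a family gives it for every sub-family (same `B₁, B₂, c₁`). Pure logic.
[cite: Balaban1985RegularSpaces, Thm 8 p.101 (bookkeeping: restriction of the family index)] -/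
theorem thm8PrintedAt_precomp (γ B₁ B₂ : ℝ) (fam : I → B8SectGH.GFData3) (h : B8SectGH.Thm8PrintedAt γ B₁ B₂ fam) :
    B8SectGH.Thm8PrintedAt γ B₁ B₂ (fun j => fam (e j)) := by
  obtain ⟨c₁, hc₁, H⟩ := h
  exact ⟨c₁, hc₁, fun j => H (e j)⟩

end Reindex

/-! ## §2 The abstract knit of the faithful leaf — Theorem 2 derived (p. 88), Lemma 1 consumed on the block-pair carriers -/

section Knit

variable {I₁ I₂ I₃ I₄ : Type} {d : ℕ} {L C₂ B₁' B₀' B₁ B₂ c₁ : ℝ} {inp : B8.B9Inputs} {B₀β : ℝ}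
  {loc : I₁ → B8.LocalData} {fam : I₂ → B8SectGH.GFData3} {lan : I₃ → B8.LandauData} {cub : I₄ → B8.CubeData}
  {toAxial : ∀ i, (fam i).Cfg → (fam i).Pert → (fam i).Pert}

/-- **THE KNIT of the faithful B8 leaf `DagBinding.B8LeafR`** from EIGHT of its nine printed statements: Lemma 1 p. 79 (`l1`), Prop 3 p. 87
(`p3`), Thm 4 p. 88 (`t4`), Prop 5 p. 94 both halves (`p5e`, `p5u`), Prop 6 p. 99 (`p6`), Prop 7 p. 100 faithful form (`p7`), Thm 8 p. 101
at γ = 1 (`t8`) — THEOREM 2 p. 83 being DERIVED by the tree's kernel form `B8.thm2_of_thm4_prop3` of the printed reduction p. 88 («Thus to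
prove Theorem 2 it suffices to prove (1.37), (1.38) and |A| < B′₁(α₀ + α₁)(Lʲη)⁻¹») from `t4`, `p3`, the threshold `c₀` of (1.65) and the six
displayed carrier laws of that theorem (its docstring names their printed sources), under the constant side conditions `1 ≤ d`, `0 < L`,
`0 < B₀(β₀)`, `0 ≤ C₂`, `5dLB₀ ≤ B′₁` ((1.111): `B′₁ = C′₁B₁`, `C′₁ ≥ 1`).  The seven remaining printed statements are HYPOTHESES named by
their tree `Prop`s — this is the discharge-shaped file of the node, not a discharge.
[cite: Balaban1985RegularSpaces, Lemma 1 p.79, Thm 2 p.83, Prop. 3 p.87, Thm 4 p.88 with «Thm 4 ⇒ Thm 2» p.88, Prop. 5 p.94, Prop. 6 p.99, Prop. 7 p.100, Thm 8 p.101] -/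
theorem b8LeafR_knit (hd : 1 ≤ d) (hL : 0 < L) (hB₀β : 0 < B₀β) (hC₂ : 0 ≤ C₂) (hB₁' : 5 * d * L * inp.B₀ ≤ B₁')
    (l1 : B8.Lemma1Printed d loc)
    (p3 : B8.Prop3Printed d L C₂ inp B₀β (fun i => (fam i).toGFData2))
    (t4 : B8.Thm4Printed B₁' (fun i => (fam i).toGFData))
    (p5e : B8.Prop5Exists B₀' B₁ lan) (p5u : B8.Prop5Unique lan) (p6 : B8.Prop6Printed d L B₁ c₁ cub)
    (p7 : B8SectGH.Prop7PrintedR fam toAxial) (t8 : B8SectGH.Thm8PrintedAt 1 B₁ B₂ fam)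
    (c₀ : ℝ) (hc₀ : 0 < c₀)
    (h165 : ∀ i α₀ α₁ (U₀ : (fam i).Cfg) (U' : (fam i).Pert), 0 < α₀ → α₀ ≤ c₀ →
      (fam i).InA α₀ U₀ → (fam i).InAAx α₀ U₀ U' → (fam i).avgClose α₁ U₀ U' →
      (fam i).avgClose166 (11 * d ^ 2 * α₀ + α₁) U₀ U')
    (hginv : ∀ i α₀ (U₀ : (fam i).Cfg) (U' : (fam i).Pert) (u : (fam i).GT),
      (fam i).InAAx α₀ U₀ U' → (fam i).InAPair α₀ U₀ ((fam i).act U' u))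
    (h137 : ∀ i α₁ b s (U₀ : (fam i).Cfg) (U' : (fam i).Pert) (u : (fam i).GT), (fam i).avgClose α₁ U₀ U' →
      (fam i).Restricted U₀ u → (fam i).C162 b s U₀ ((fam i).act U' u) → (fam i).C137 α₁ U₀ ((fam i).act U' u))
    (h136_162 : ∀ i b b₂ s (U₀ : (fam i).Cfg) (U₁ : (fam i).Pert),
      (fam i).C136 b b₂ s U₀ U₁ → (fam i).C162 b s U₀ U₁)
    (hmono162 : ∀ i b s b' s' (U₀ : (fam i).Cfg) (U₁ : (fam i).Pert), b * s ≤ b' * s' →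
      (fam i).C162 b s U₀ U₁ → (fam i).C162 b' s' U₀ U₁)
    (hmono137 : ∀ i α₁ α₁' (U₀ : (fam i).Cfg) (U₁ : (fam i).Pert), α₁ ≤ α₁' →
      (fam i).C137 α₁ U₀ U₁ → (fam i).C137 α₁' U₀ U₁) :
    B8LeafR d L C₂ B₁' B₀' B₁ B₂ c₁ inp B₀β loc fam lan cub toAxial where
  l1 := l1
  t2 := B8.thm2_of_thm4_prop3 d L C₂ B₁' inp B₀β (fun i => (fam i).toGFData2) hd hL hB₀β hC₂ hB₁' t4 p3 c₀ hc₀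
    h165 hginv h137 h136_162 hmono162 hmono137
  p3 := p3
  t4 := t4
  p5e := p5e
  p5u := p5u
  p6 := p6
  p7 := p7
  t8 := t8

/-- **The knit with Lemma 1 CONSUMED BY NAME** on the non-abelian block-pair carriers `B8Lemma1NonAbelian.blockPairNA d Lb 𝔸` (every natural
block size `Lb`, every complete normed `ℂ`-algebra `𝔸` with `‖1‖ = 1`; `DagDischargedII.lemma1Printed_blockPairNA`): SEVEN named printed
hypotheses remain — `p3 t4 p5e p5u p6 p7 t8` — plus the (1.65) threshold and the six carrier laws of `B8.thm2_of_thm4_prop3`.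
[cite: Balaban1985RegularSpaces, Lemma 1 (1.24)–(1.25) pp.79–80 (kernel version on the typed non-abelian block-pair carriers), Thm 2 – Thm 8 pp.83–101 (named hypotheses)] -/
theorem b8LeafR_knit_blockPairNA (Lb : ℕ) (𝔸 : Type) [NormedRing 𝔸] [NormOneClass 𝔸] [NormedAlgebra ℂ 𝔸] [CompleteSpace 𝔸]
    (hd : 1 ≤ d) (hL : 0 < L) (hB₀β : 0 < B₀β) (hC₂ : 0 ≤ C₂) (hB₁' : 5 * d * L * inp.B₀ ≤ B₁')
    (p3 : B8.Prop3Printed d L C₂ inp B₀β (fun i => (fam i).toGFData2))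
    (t4 : B8.Thm4Printed B₁' (fun i => (fam i).toGFData))
    (p5e : B8.Prop5Exists B₀' B₁ lan) (p5u : B8.Prop5Unique lan) (p6 : B8.Prop6Printed d L B₁ c₁ cub)
    (p7 : B8SectGH.Prop7PrintedR fam toAxial) (t8 : B8SectGH.Thm8PrintedAt 1 B₁ B₂ fam)
    (c₀ : ℝ) (hc₀ : 0 < c₀)
    (h165 : ∀ i α₀ α₁ (U₀ : (fam i).Cfg) (U' : (fam i).Pert), 0 < α₀ → α₀ ≤ c₀ →
      (fam i).InA α₀ U₀ → (fam i).InAAx α₀ U₀ U' → (fam i).avgClose α₁ U₀ U' →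
      (fam i).avgClose166 (11 * d ^ 2 * α₀ + α₁) U₀ U')
    (hginv : ∀ i α₀ (U₀ : (fam i).Cfg) (U' : (fam i).Pert) (u : (fam i).GT),
      (fam i).InAAx α₀ U₀ U' → (fam i).InAPair α₀ U₀ ((fam i).act U' u))
    (h137 : ∀ i α₁ b s (U₀ : (fam i).Cfg) (U' : (fam i).Pert) (u : (fam i).GT), (fam i).avgClose α₁ U₀ U' →
      (fam i).Restricted U₀ u → (fam i).C162 b s U₀ ((fam i).act U' u) → (fam i).C137 α₁ U₀ ((fam i).act U' u))
    (h136_162 : ∀ i b b₂ s (U₀ : (fam i).Cfg) (U₁ : (fam i).Pert),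
      (fam i).C136 b b₂ s U₀ U₁ → (fam i).C162 b s U₀ U₁)
    (hmono162 : ∀ i b s b' s' (U₀ : (fam i).Cfg) (U₁ : (fam i).Pert), b * s ≤ b' * s' →
      (fam i).C162 b s U₀ U₁ → (fam i).C162 b' s' U₀ U₁)
    (hmono137 : ∀ i α₁ α₁' (U₀ : (fam i).Cfg) (U₁ : (fam i).Pert), α₁ ≤ α₁' →
      (fam i).C137 α₁ U₀ U₁ → (fam i).C137 α₁' U₀ U₁) :
    B8LeafR d L C₂ B₁' B₀' B₁ B₂ c₁ inp B₀β (B8Lemma1NonAbelian.blockPairNA d Lb 𝔸) fam lan cub toAxial :=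
  b8LeafR_knit hd hL hB₀β hC₂ hB₁' (lemma1Printed_blockPairNA d Lb 𝔸) p3 t4 p5e p5u p6 p7 t8 c₀ hc₀ h165 hginv h137 h136_162
    hmono162 hmono137

end Knit

/-! ## §3 The node N05 at a run: from the leaf, and at an N-binding run from the knit over the run's own B8 group -/

section Node

variable (w : WorldP) (P : B12.RunParams)

/-- **N05 from its leaf, in-edges discarded**: if the run's bound `b8` leaf holds, `Dag.B8_main (leavesP w P)` («b5 → b6 → b7 → b9 → b8») holds —
the shape of N04's knit (`Node00.b7_main_of_isWorldOfRecord₂`: «the antecedent is not used»). [cite: Balaban1985RegularSpaces, Thm 2 p.83, Thm 4 p.88, Thm 8 p.101 (node bookkeeping)] -/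
theorem b8_main_of_leaf (h : (w.up P).b8) : Dag.B8_main (leavesP w P) :=
  fun _ _ _ _ => h

/-- **N05 IS its leaf once the four in-edge leaves hold** (b5 = N02's, b6 = N03's, b7 = N04's, b9 = N06's conclusion at the same run).
[cite: Balaban1985RegularSpaces, p.75 [3], p.92 «Theorems 3.1, 3.2 of [4]», pp.86–87 «Theorem 3.3 of [4]» (the node's in-edges; bookkeeping)] -/
theorem b8_main_iff_leaf (h5 : (w.up P).b5) (h6 : (w.up P).b6) (h7 : (w.up P).b7) (h9 : (w.up P).b9) :
    Dag.B8_main (leavesP w P) ↔ (w.up P).b8 :=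
  ⟨fun h => h h5 h6 h7 h9, fun h _ _ _ _ => h⟩

variable (X : PrintedCarriersR) (Y : PrintedCarriers9X) (Z : PrintedCarriers11) (V : PrintedCarriers14R) (W : PrintedCarriers15)

/-- **The `b8` field of NODE 00's N-binding IS the faithful leaf over the bundle's B8 group** (definitional: `ofPrintedAllXPN` re-binds `b4` only,
`ofPrintedAllXP` re-binds `b6` only, `ofPrintedAllX` keeps `ofPrintedR`'s `b8 := B8LeafR … X.fam8R …`). [cite: Balaban1985RegularSpaces, Lemma 1 – Thm 8 pp.79–101 (the bound leaf; bookkeeping)] -/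
theorem ofPrintedAllXPN_b8_iff :
    (Upstream.ofPrintedAllXPN X Y Z V W).b8 ↔
      B8LeafR X.d8 X.L8 X.C₂ X.B₁' X.B₀' X.B₁ X.B₂ X.c₁ X.inp8 X.B₀β X.loc8 X.fam8R X.lan8 X.cub8 X.toAxial8 :=
  Iff.rfl

variable {w P X Y Z V W}

/-- **N05 at a run bound by the N-binding, from the faithful leaf over the run's B8 group** (explicit-parameter shape, R422).
[cite: Balaban1985RegularSpaces, Lemma 1 – Thm 8 pp.79–101 (node bookkeeping)] -/
theorem b8_main_of_up (hup : w.up P = Upstream.ofPrintedAllXPN X Y Z V W)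
    (h : B8LeafR X.d8 X.L8 X.C₂ X.B₁' X.B₀' X.B₁ X.B₂ X.c₁ X.inp8 X.B₀β X.loc8 X.fam8R X.lan8 X.cub8 X.toAxial8) :
    Dag.B8_main (leavesP w P) := by
  refine b8_main_of_leaf w P ?_
  rw [hup]
  exact h

/-- **N05 at a run bound by the N-binding, KNIT from the run's own B8 data**: eight named printed statements over `X`'s B8 group (Theorem 2
derived, p. 88) + the (1.65) threshold + the six carrier laws + the constant side conditions on `X.d8, X.L8, X.B₀β, X.C₂, X.B₁', X.inp8`.  The
discharge-shaped statement of the node with its hypotheses DISPLAYED; each hypothesis a -b seat lands as a theorem on the B8 family of record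
is deleted from this list by the successor file. [cite: Balaban1985RegularSpaces, Lemma 1 p.79, Prop. 3 p.87, Thm 4 p.88 with «Thm 4 ⇒ Thm 2» p.88, Prop. 5 p.94, Prop. 6 p.99, Prop. 7 p.100, Thm 8 p.101 (named hypotheses; node bookkeeping)] -/
theorem b8_main_of_up_knit (hup : w.up P = Upstream.ofPrintedAllXPN X Y Z V W)
    (hd : 1 ≤ X.d8) (hL : 0 < X.L8) (hB₀β : 0 < X.B₀β) (hC₂ : 0 ≤ X.C₂) (hB₁' : 5 * X.d8 * X.L8 * X.inp8.B₀ ≤ X.B₁')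
    (l1 : B8.Lemma1Printed X.d8 X.loc8)
    (p3 : B8.Prop3Printed X.d8 X.L8 X.C₂ X.inp8 X.B₀β (fun i => (X.fam8R i).toGFData2))
    (t4 : B8.Thm4Printed X.B₁' (fun i => (X.fam8R i).toGFData))
    (p5e : B8.Prop5Exists X.B₀' X.B₁ X.lan8) (p5u : B8.Prop5Unique X.lan8) (p6 : B8.Prop6Printed X.d8 X.L8 X.B₁ X.c₁ X.cub8)
    (p7 : B8SectGH.Prop7PrintedR X.fam8R X.toAxial8) (t8 : B8SectGH.Thm8PrintedAt 1 X.B₁ X.B₂ X.fam8R)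
    (c₀ : ℝ) (hc₀ : 0 < c₀)
    (h165 : ∀ i α₀ α₁ (U₀ : (X.fam8R i).Cfg) (U' : (X.fam8R i).Pert), 0 < α₀ → α₀ ≤ c₀ →
      (X.fam8R i).InA α₀ U₀ → (X.fam8R i).InAAx α₀ U₀ U' → (X.fam8R i).avgClose α₁ U₀ U' →
      (X.fam8R i).avgClose166 (11 * X.d8 ^ 2 * α₀ + α₁) U₀ U')
    (hginv : ∀ i α₀ (U₀ : (X.fam8R i).Cfg) (U' : (X.fam8R i).Pert) (u : (X.fam8R i).GT),
      (X.fam8R i).InAAx α₀ U₀ U' → (X.fam8R i).InAPair α₀ U₀ ((X.fam8R i).act U' u))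
    (h137 : ∀ i α₁ b s (U₀ : (X.fam8R i).Cfg) (U' : (X.fam8R i).Pert) (u : (X.fam8R i).GT), (X.fam8R i).avgClose α₁ U₀ U' →
      (X.fam8R i).Restricted U₀ u → (X.fam8R i).C162 b s U₀ ((X.fam8R i).act U' u) → (X.fam8R i).C137 α₁ U₀ ((X.fam8R i).act U' u))
    (h136_162 : ∀ i b b₂ s (U₀ : (X.fam8R i).Cfg) (U₁ : (X.fam8R i).Pert),
      (X.fam8R i).C136 b b₂ s U₀ U₁ → (X.fam8R i).C162 b s U₀ U₁)
    (hmono162 : ∀ i b s b' s' (U₀ : (X.fam8R i).Cfg) (U₁ : (X.fam8R i).Pert), b * s ≤ b' * s' →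
      (X.fam8R i).C162 b s U₀ U₁ → (X.fam8R i).C162 b' s' U₀ U₁)
    (hmono137 : ∀ i α₁ α₁' (U₀ : (X.fam8R i).Cfg) (U₁ : (X.fam8R i).Pert), α₁ ≤ α₁' →
      (X.fam8R i).C137 α₁ U₀ U₁ → (X.fam8R i).C137 α₁' U₀ U₁) :
    Dag.B8_main (leavesP w P) :=
  b8_main_of_up hup (b8LeafR_knit hd hL hB₀β hC₂ hB₁' l1 p3 t4 p5e p5u p6 p7 t8 c₀ hc₀ h165 hginv h137 h136_162 hmono162 hmono137)

/-- **The same knit at a run whose Lemma-1 carriers are the non-abelian block pairs** (`X.withBlockPairNA Lb 𝔸`, `DagDischargedII`): Lemma 1 is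
no longer a hypothesis; the substituted bundle's gauge-fixing, Landau and cube families and constants are `X`'s own (`rfl`).
[cite: Balaban1985RegularSpaces, Lemma 1 (1.24)–(1.25) pp.79–80 (kernel version on the typed non-abelian block-pair carriers), Prop. 3 – Thm 8 pp.87–101 (named hypotheses; node bookkeeping)] -/
theorem b8_main_of_up_knit_withBlockPairNA (Lb : ℕ) (𝔸 : Type) [NormedRing 𝔸] [NormOneClass 𝔸] [NormedAlgebra ℂ 𝔸] [CompleteSpace 𝔸]
    (hup : w.up P = Upstream.ofPrintedAllXPN (X.withBlockPairNA Lb 𝔸) Y Z V W)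
    (hd : 1 ≤ X.d8) (hL : 0 < X.L8) (hB₀β : 0 < X.B₀β) (hC₂ : 0 ≤ X.C₂) (hB₁' : 5 * X.d8 * X.L8 * X.inp8.B₀ ≤ X.B₁')
    (p3 : B8.Prop3Printed X.d8 X.L8 X.C₂ X.inp8 X.B₀β (fun i => (X.fam8R i).toGFData2))
    (t4 : B8.Thm4Printed X.B₁' (fun i => (X.fam8R i).toGFData))
    (p5e : B8.Prop5Exists X.B₀' X.B₁ X.lan8) (p5u : B8.Prop5Unique X.lan8) (p6 : B8.Prop6Printed X.d8 X.L8 X.B₁ X.c₁ X.cub8)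
    (p7 : B8SectGH.Prop7PrintedR X.fam8R X.toAxial8) (t8 : B8SectGH.Thm8PrintedAt 1 X.B₁ X.B₂ X.fam8R)
    (c₀ : ℝ) (hc₀ : 0 < c₀)
    (h165 : ∀ i α₀ α₁ (U₀ : (X.fam8R i).Cfg) (U' : (X.fam8R i).Pert), 0 < α₀ → α₀ ≤ c₀ →
      (X.fam8R i).InA α₀ U₀ → (X.fam8R i).InAAx α₀ U₀ U' → (X.fam8R i).avgClose α₁ U₀ U' →
      (X.fam8R i).avgClose166 (11 * X.d8 ^ 2 * α₀ + α₁) U₀ U')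
    (hginv : ∀ i α₀ (U₀ : (X.fam8R i).Cfg) (U' : (X.fam8R i).Pert) (u : (X.fam8R i).GT),
      (X.fam8R i).InAAx α₀ U₀ U' → (X.fam8R i).InAPair α₀ U₀ ((X.fam8R i).act U' u))
    (h137 : ∀ i α₁ b s (U₀ : (X.fam8R i).Cfg) (U' : (X.fam8R i).Pert) (u : (X.fam8R i).GT), (X.fam8R i).avgClose α₁ U₀ U' →
      (X.fam8R i).Restricted U₀ u → (X.fam8R i).C162 b s U₀ ((X.fam8R i).act U' u) → (X.fam8R i).C137 α₁ U₀ ((X.fam8R i).act U' u))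
    (h136_162 : ∀ i b b₂ s (U₀ : (X.fam8R i).Cfg) (U₁ : (X.fam8R i).Pert),
      (X.fam8R i).C136 b b₂ s U₀ U₁ → (X.fam8R i).C162 b s U₀ U₁)
    (hmono162 : ∀ i b s b' s' (U₀ : (X.fam8R i).Cfg) (U₁ : (X.fam8R i).Pert), b * s ≤ b' * s' →
      (X.fam8R i).C162 b s U₀ U₁ → (X.fam8R i).C162 b' s' U₀ U₁)
    (hmono137 : ∀ i α₁ α₁' (U₀ : (X.fam8R i).Cfg) (U₁ : (X.fam8R i).Pert), α₁ ≤ α₁' →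
      (X.fam8R i).C137 α₁ U₀ U₁ → (X.fam8R i).C137 α₁' U₀ U₁) :
    Dag.B8_main (leavesP w P) :=
  b8_main_of_up hup (b8LeafR_knit_blockPairNA Lb 𝔸 hd hL hB₀β hC₂ hB₁' p3 t4 p5e p5u p6 p7 t8 c₀ hc₀ h165 hginv h137 h136_162
    hmono162 hmono137)

end Node

/-! ## §4 The two located hazards on the shared gauge-fixing family, in node form -/

section Hazards

variable {I : Type}

/-- **A gauge-fixing family CONTAINING print's admitted flat abelian torus instances at every number of RG steps `K` does NOT satisfy
Theorem 8 as printed at γ = 1, for ANY constants `B₁, B₂`** (`d ≥ 2`): restrict to the sub-family (§1) and apply the cell's kernel refutation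
`B8Thm8FlatAbelianFamily.not_thm8PrintedAt` (GAPS G-B8-13: for sources with `|f|₍₋₂₎ < γ(α₀ + α₁)` only, the ∇-member of (1.36) fails
`K`-uniformly — `U₀ = 1`, `U′ = 1`, all `Ω_j = T_η`, the instance print admits on p. 77).
[cite: Balaban1985RegularSpaces, Thm 8 p.101 + (1.36) p.82 + p.77 «we admit the case where some domains Ω_j are equal to T_η»] -/
theorem not_thm8PrintedAt_of_flat_subfamily (P : Params) (hd : 2 ≤ P.d) (fam : I → B8SectGH.GFData3) (e : ℕ → I)
    (he : ∀ K, fam (e K) = B8Thm8FlatAbelianFamily.flatGF (B8Thm8TorusWitness.withK P K)) (B₁ B₂ : ℝ) :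
    ¬ B8SectGH.Thm8PrintedAt 1 B₁ B₂ fam := by
  intro h
  have hsub := thm8PrintedAt_precomp e 1 B₁ B₂ fam h
  have hfun : (fun K => fam (e K)) = fun K => B8Thm8FlatAbelianFamily.flatGF (B8Thm8TorusWitness.withK P K) := funext he
  rw [hfun] at hsub
  exact B8Thm8FlatAbelianFamily.not_thm8PrintedAt P hd B₁ B₂ hsub

/-- **The faithful B8 leaf is FALSE over any gauge-fixing family containing the admitted flat abelian torus instances at every `K`** — through
its conjunct `t8` alone, whatever the Lemma-1, Landau and cube data, the axial-gauge map and the constants.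
[cite: Balaban1985RegularSpaces, Thm 8 p.101 + (1.36) p.82 (the leaf's conjunct t8 on the admitted flat instances)] -/
theorem not_b8LeafR_of_flat_subfamily (P : Params) (hd : 2 ≤ P.d) {I₁ I₃ I₄ : Type} (d : ℕ) (L C₂ B₁' B₀' B₁ B₂ c₁ : ℝ)
    (inp : B8.B9Inputs) (B₀β : ℝ) (loc : I₁ → B8.LocalData) (fam : I → B8SectGH.GFData3) (lan : I₃ → B8.LandauData)
    (cub : I₄ → B8.CubeData) (toAxial : ∀ i, (fam i).Cfg → (fam i).Pert → (fam i).Pert) (e : ℕ → I)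
    (he : ∀ K, fam (e K) = B8Thm8FlatAbelianFamily.flatGF (B8Thm8TorusWitness.withK P K)) :
    ¬ B8LeafR d L C₂ B₁' B₀' B₁ B₂ c₁ inp B₀β loc fam lan cub toAxial :=
  fun h => not_thm8PrintedAt_of_flat_subfamily P hd fam e he B₁ B₂ h.t8

variable {w : WorldP} {P₀ : B12.RunParams} {X : PrintedCarriersR} {Y : PrintedCarriers9X} {Z : PrintedCarriers11} {V : PrintedCarriers14R}
  {W : PrintedCarriers15}

/-- **At the N-binding: a bundle whose gauge-fixing family `fam8R` contains the admitted flat instances has a FALSE `b8` field.**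
[cite: Balaban1985RegularSpaces, Thm 8 p.101 + (1.36) p.82 (bound leaf on the admitted flat instances; bookkeeping)] -/
theorem not_ofPrintedAllXPN_b8_of_flat_subfamily (P : Params) (hd : 2 ≤ P.d) (e : ℕ → X.I8b)
    (he : ∀ K, X.fam8R (e K) = B8Thm8FlatAbelianFamily.flatGF (B8Thm8TorusWitness.withK P K)) :
    ¬ (Upstream.ofPrintedAllXPN X Y Z V W).b8 :=
  not_b8LeafR_of_flat_subfamily P hd X.d8 X.L8 X.C₂ X.B₁' X.B₀' X.B₁ X.B₂ X.c₁ X.inp8 X.B₀β X.loc8 X.fam8R X.lan8 X.cub8 X.toAxial8 e he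

/-- **N05 at a run so bound holds IFF ONE OF ITS IN-EDGE LEAVES FAILS** (b5 = [Balaban1984PropagatorsI] Props 1.1–1.2, b6 = [Balaban1984PropagatorsII]
block, b7 = [Balaban1985Averaging] Props 1–10, b9 = [Balaban1985BackgroundPropagators] Thms 3.1–3.15 at the same run): ex falso only — the
YM-PLAN §1 vacuity guard in kernel form for leaf b8.  Consequence for NODE 00 question N0-6: a B8 family of record carrying the leaf AS TYPED
must exclude the admitted flat instances, i.e. conjunct `t8` wants re-typing (surviving form `B8.Thm8Inspected`) before N05 is dischargeable
at honest carriers. [cite: Balaban1985RegularSpaces, Thm 8 p.101 (node bookkeeping on the admitted flat instances)] -/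
theorem b8_main_iff_inEdge_fails_of_flat_subfamily (hup : w.up P₀ = Upstream.ofPrintedAllXPN X Y Z V W) (P : Params) (hd : 2 ≤ P.d)
    (e : ℕ → X.I8b) (he : ∀ K, X.fam8R (e K) = B8Thm8FlatAbelianFamily.flatGF (B8Thm8TorusWitness.withK P K)) :
    Dag.B8_main (leavesP w P₀) ↔ ¬ ((w.up P₀).b5 ∧ (w.up P₀).b6 ∧ (w.up P₀).b7 ∧ (w.up P₀).b9) := by
  have hnot : ¬ (w.up P₀).b8 := by
    rw [hup]
    exact not_ofPrintedAllXPN_b8_of_flat_subfamily P hd e he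
  constructor
  · rintro h ⟨h5, h6, h7, h9⟩
    exact hnot (h h5 h6 h7 h9)
  · intro h h5 h6 h7 h9
    exact absurd ⟨h5, h6, h7, h9⟩ h

/-- **The faithful leaf is FALSE over r05's half-space packaging** `B8Prop7HalfSpace.halfspaceGF 4 3 0 ℂ` with print's axial map `toAxialHS` —
through conjunct `p7` (`B8Prop7HalfSpace.not_prop7PrintedR_halfspace`: the constant `2α₂` of (1.145) fails on a bond crossing into `Λ₁`;
the repaired constant holds there, `prop7RepairedC`).  NODE 00 question N0-6 in leaf form. [cite: Balaban1985RegularSpaces, Prop. 7 (1.144)–(1.145) p.100 (the leaf's conjunct p7 on the half-space instances)] -/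
theorem not_b8LeafR_halfspace {I₁ I₃ I₄ : Type} (d : ℕ) (L C₂ B₁' B₀' B₁ B₂ c₁ : ℝ) (inp : B8.B9Inputs) (B₀β : ℝ)
    (loc : I₁ → B8.LocalData) (lan : I₃ → B8.LandauData) (cub : I₄ → B8.CubeData) :
    ¬ B8LeafR d L C₂ B₁' B₀' B₁ B₂ c₁ inp B₀β loc (B8Prop7HalfSpace.halfspaceGF 4 3 (0 : Fin 4) ℂ) lan cub
        (B8Prop7HalfSpace.toAxialHS 4 3 (by norm_num) (0 : Fin 4) ℂ) :=
  fun h => B8Prop7HalfSpace.not_prop7PrintedR_halfspace h.p7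

end Hazards

end Literature.MathematicalPhysics.QuantumFieldTheory.Balaban1983to89.B8LeafKnit
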